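import Literature.MathematicalPhysics.QuantumManyBody.PeriodicBoseGasPairMarginal
import Literature.MathematicalPhysics.QuantumManyBody.PeriodicBoseGasEq225
import Literature.MathematicalPhysics.QuantumManyBody.PeriodicBoseGasEq242
import Literature.MathematicalPhysics.QuantumManyBody.PeriodicBoseGasBogoliubovPlancherel
import Literature.Analysis.FluidPDE.KochTataruSymbol
import HarnessLib

/-!
# Fournais 2020, (2.29) proved on the form domain: `⟨Φ, A₂Φ⟩ = ∫ Ŵ₁(p) Re⟨b_p†Φ, b_{-p}Φ⟩ dp`

Topic `Literature/MathematicalPhysics/QuantumManyBody` (provefact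
`Literature.MathematicalPhysics.QuantumManyBody.BoseGas.Fournais2020_lemma24`). The pairing identity
[Fournais2020, (2.29)] "a direct calculation gives `A₂ = ½(2π)⁻³∫Ŵ₁(k)(b_k†b_{-k}† + b_kb_{-k})dk`" is the
one input of the assembly `Fournais2020_lemma24_of_facts` (`PeriodicBoseGasLemma24.lean`) that was not
discharged. As vendored (`Fournais2020_eq229`, `PeriodicBoseGasLemma24Facts.lean`) it is asked for every
measurable `Φ` of finite norm and kinetic form; but `⟨Φ, A₂Φ⟩` (`a2Form`) is a Bochner integral of
`conj(PᵢPⱼΦ)·w₁(xᵢ,xⱼ)·QⱼQᵢΦ` with `w₁ ∈ L¹` only, which is integrable on the **form domain** of the box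
Hamiltonian — finite repulsion `⟨Φ, ∑_{i<j}w(xᵢ,xⱼ)Φ⟩ < ∞`, exactly the hypothesis carried (unused so far)
by `Fournais2020_lemma24` — and not obviously otherwise. This file proves (2.29) **with** that
hypothesis (`Fournais2020_eq229_of_rep`), which is what Lemma 2.4 needs:

1. per pair `i ≠ j` and for a *bounded* even potential `U ∈ L¹`, Plancherel's polarisation identity
   (`Literature.Analysis.FluidPDE.re_integral_conj_fourier_mul_eq`) between `U` and the pair-difference
   marginal `G ∈ L¹ ∩ L²` of `K = χ_Λ(xᵢ)χ_Λ(xⱼ)conj(PᵢPⱼΦ)QⱼQᵢΦ` (`PeriodicBoseGasPairMarginal.lean`):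
   `Re∫_{Λⁿ}U(xᵢ-xⱼ)K = Re∫𝓕U·𝓕G`, `𝓕G(p) = ⟨(Qφ_p)ᵢPᵢΦ, Pⱼφ_{p,j}QⱼΦ⟩` (step I,
   `integral_conj_bDagVec_mul_bVec`), summed over pairs: `∑ Re∫U K_{ij} = ∫ 𝓕U(p) Re⟨b_p†Φ,b_{-p}Φ⟩dp`;
2. `U = min(W₁, N) ↑ W₁`: on the left dominated convergence (dominant `w₁|PᵢPⱼΦ||QⱼQᵢΦ| ∈ L¹` by finite
   repulsion, `PeriodicBoseGasEq225.lean`); on the right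
   `|∫𝓕(W₁-U)Re⟨b†Φ,bΦ⟩| ≤ sup‖b_p†Φ‖ (∫|𝓕(W₁-U)|²/(4π²p²))^{1/2} (∫4π²p²‖b_pΦ‖²)^{1/2}`, where the last
   factor is finite by (2.30) and (2.32) (finite kinetic form) and the Coulomb energy of `W₁ - U ↓ 0`
   tends to `0` (`lintegral_normSq_fourier_div_eq` and dominated convergence; it is finite by (2.42),
   `Fournais2020_eq242_holds`).

No new definitions.

## References

* [Fournais2020] S. Fournais, *Length scales for BEC in the dilute Bose gas*, arXiv:2011.00309,
  EMS Ser. Congr. Rep. 18 (2021), doi:10.4171/ecr/18-1/7: (2.24), (2.27)–(2.32), (2.42).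
* [FournaisSolovej2020] S. Fournais, J. P. Solovej, *The energy of dilute Bose gases*,
  Ann. of Math. 192 (2020) 893–976: §6, App. A.
-/

noncomputable section

open MeasureTheory Set Filter
open scoped ENNReal NNReal FourierTransform ComplexConjugate RealInnerProductSpace Topology

namespace Literature.MathematicalPhysics.QuantumManyBody.BoseGas

/-! ### Real even functions have real Fourier transforms -/

section RealEven

/-- `conj(𝓕f(p)) = 𝓕f(p)` for a real even `f` (`conj 𝓕f = 𝓕⁻f = 𝓕(f ∘ neg)`). [folklore] -/
theorem conj_fourier_ofReal_even {f : Space → ℝ} (hf : ∀ x, f (-x) = f x) (p : Space) :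
    conj (𝓕 (fun x : Space => (f x : ℂ)) p) = 𝓕 (fun x : Space => (f x : ℂ)) p := by
  have h1 : conj (𝓕 (fun x : Space => (f x : ℂ)) p) = 𝓕⁻ (fun x : Space => (f x : ℂ)) p := by
    rw [Real.fourier_eq, Real.fourierInv_eq, ← integral_conj]
    refine integral_congr_ae (Eventually.of_forall fun v => ?_)
    simp only [Circle.smul_def, smul_eq_mul, map_mul, Complex.conj_ofReal, ← Circle.coe_inv_eq_conj,
      ← AddChar.map_neg_eq_inv, neg_neg]
  rw [h1, Real.fourierInv_eq_fourier_comp_neg]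
  simp only [hf]

/-- The Fourier transform of a real even function is real. [folklore] -/
theorem im_fourier_ofReal_even {f : Space → ℝ} (hf : ∀ x, f (-x) = f x) (p : Space) :
    (𝓕 (fun x : Space => (f x : ℂ)) p).im = 0 :=
  Complex.conj_eq_iff_im.1 (conj_fourier_ofReal_even hf p)

/-- `Re(𝓕f(p)·z) = Re(𝓕f(p))·Re(z)` for a real even `f`. [folklore] -/
theorem re_fourier_ofReal_even_mul {f : Space → ℝ} (hf : ∀ x, f (-x) = f x) (p : Space) (z : ℂ) :
    (𝓕 (fun x : Space => (f x : ℂ)) p * z).re = (𝓕 (fun x : Space => (f x : ℂ)) p).re * z.re := by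
  rw [Complex.mul_re, im_fourier_ofReal_even hf p, zero_mul, sub_zero]

end RealEven

/-! ### Truncations `min(g, N) ↑ g` under the integral sign -/

section Truncation

variable {α : Type*} [MeasurableSpace α] {μ : Measure α}

/-- **Dominated convergence for truncated weights**: for `g ≥ 0` with `g·K ∈ L¹`,
`∫ min(g, N) K → ∫ g K` as `N → ∞`. [folklore] -/
theorem tendsto_integral_min_mul {g : α → ℝ} (hgm : Measurable g) (hg0 : ∀ x, 0 ≤ g x) {K : α → ℂ}
    (hKm : AEStronglyMeasurable K μ) (hint : Integrable (fun x => (g x : ℂ) * K x) μ) :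
    Tendsto (fun N : ℕ => ∫ x, ((min (g x) N : ℝ) : ℂ) * K x ∂μ) atTop (𝓝 (∫ x, (g x : ℂ) * K x ∂μ)) := by
  refine tendsto_integral_of_dominated_convergence (fun x => ‖(g x : ℂ) * K x‖) (fun N => ?_) hint.norm
    (fun N => Eventually.of_forall fun x => ?_) (Eventually.of_forall fun x => ?_)
  · exact (Complex.measurable_ofReal.comp (hgm.min measurable_const)).aestronglyMeasurable.mul hKm
  · rw [norm_mul, norm_mul, Complex.norm_real, Complex.norm_real, Real.norm_of_nonneg (hg0 x),
      Real.norm_of_nonneg (le_min (hg0 x) (Nat.cast_nonneg N))]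
    exact mul_le_mul_of_nonneg_right (min_le_left _ _) (norm_nonneg _)
  · have hmin : Tendsto (fun N : ℕ => (min (g x) N : ℝ)) atTop (𝓝 (g x)) := by
      refine tendsto_const_nhds.congr' ?_
      filter_upwards [Filter.eventually_ge_atTop ⌈g x⌉₊] with N hN
      rw [min_eq_left ((Nat.le_ceil (g x)).trans (by exact_mod_cast hN))]
    exact ((Complex.continuous_ofReal.tendsto _).comp hmin).mul tendsto_const_nhds

end Truncation

/-! ### The per-pair Parseval identity for a bounded even potential -/

section Pair

variable {m : ℕ} {χ : Space → ℝ} {ℓ : ℝ} {u : Space}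

/-- The inner product of the localised waves as a character of the pair difference:
`conj(φ_p(x))φ_p(y) = χ_Λ(x)χ_Λ(y)e^{-2πi⟨x - y, p⟩}`. [cite: Fournais2020, (2.27)] -/
theorem conj_locWave_mul_locWave' (χ : Space → ℝ) (ℓ : ℝ) (u p x y : Space) :
    conj (locWave χ ℓ u p x) * locWave χ ℓ u p y =
      (𝐞 (-⟪x - y, p⟫) : ℂ) * ((locFun χ ℓ u x : ℂ) * (locFun χ ℓ u y : ℂ)) := by
  rw [conj_locWave_mul_locWave, ← neg_sub, inner_neg_left, Complex.ofReal_mul]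
  ring

/-- **(2.29) for one pair and a bounded even potential.** For `Φ ∈ L²(Λ(u)ⁿ⁺¹)`, `i ≠ j`, and a real,
even, bounded `U ∈ L¹(ℝ³)`: with `K = conj(PᵢPⱼΦ)·χ_Λ(xᵢ)χ_Λ(xⱼ)·QⱼQᵢΦ` and
`S(p) = ∫_{Λⁿ⁺¹} conj(PᵢPⱼΦ) conj(φ_p(xᵢ))φ_p(xⱼ) QⱼQᵢΦ` (the `(i,j)` term of `⟨b_p†Φ, b_{-p}Φ⟩`,
`integral_conj_bDagVec_mul_bVec`), `𝓕U·S ∈ L¹(dp)` and `Re∫_{Λⁿ⁺¹} U(xᵢ - xⱼ) K dX = Re∫ 𝓕U(p) S(p) dp`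
(Plancherel polarisation between `U` and the pair-difference marginal of `K`, which is `L¹ ∩ L²`).
[cite: Fournais2020, (2.29)] -/
theorem re_integral_pairPotential_eq (hχ : IsLocalizationFunction χ) (hℓ : 0 < ℓ) {i j : Fin (m + 1)}
    (hij : i ≠ j) {Φ : Config (m + 1) → ℂ} (hΦm : Measurable Φ)
    (hΦ2 : MemLp Φ 2 ((volume : Measure (Config (m + 1))).restrict (boxConfig (m + 1) ℓ u)))
    {U : Space → ℝ} (hUm : Measurable U) (hUe : ∀ x, U (-x) = U x) {M : ℝ} (hUb : ∀ x, |U x| ≤ M)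
    (hUi : Integrable U) :
    Integrable (fun p : Space => 𝓕 (fun x : Space => (U x : ℂ)) p *
        ∫ X in boxConfig (m + 1) ℓ u, conj (nbodyP ℓ u i (nbodyP ℓ u j Φ) X) *
          (conj (locWave χ ℓ u p (X i)) * locWave χ ℓ u p (X j)) * nbodyQ ℓ u j (nbodyQ ℓ u i Φ) X) ∧
      (∫ X in boxConfig (m + 1) ℓ u, (U (X i - X j) : ℂ) *
          (conj (nbodyP ℓ u i (nbodyP ℓ u j Φ) X) *
            ((locFun χ ℓ u (X i) : ℂ) * ((locFun χ ℓ u (X j) : ℂ) * nbodyQ ℓ u j (nbodyQ ℓ u i Φ) X)))).re =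
        (∫ p : Space, 𝓕 (fun x : Space => (U x : ℂ)) p *
          ∫ X in boxConfig (m + 1) ℓ u, conj (nbodyP ℓ u i (nbodyP ℓ u j Φ) X) *
            (conj (locWave χ ℓ u p (X i)) * locWave χ ℓ u p (X j)) * nbodyQ ℓ u j (nbodyQ ℓ u i Φ) X).re := by
  set μ : Measure (Config (m + 1)) := (volume : Measure (Config (m + 1))).restrict (boxConfig (m + 1) ℓ u) with hμ
  obtain ⟨Cχ, hCχ⟩ := hχ.exists_bound
  -- the two factors of `K = conj(A)·Mf`
  set A : Config (m + 1) → ℂ := nbodyP ℓ u i (nbodyP ℓ u j Φ) with hA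
  set Mf : Config (m + 1) → ℂ := fun X =>
    (locFun χ ℓ u (X i) : ℂ) * ((locFun χ ℓ u (X j) : ℂ) * nbodyQ ℓ u j (nbodyQ ℓ u i Φ) X) with hMf
  have hAm : Measurable A := measurable_nbodyP ℓ u i (measurable_nbodyP ℓ u j hΦm)
  have hA2 : MemLp A 2 μ := memLp_nbodyP hℓ i (measurable_nbodyP ℓ u j hΦm) (memLp_nbodyP hℓ j hΦm hΦ2)
  have hAu : ∀ X y, A (Function.update X i y) = A X := fun X y => nbodyP_update ℓ u i _ X y
  have hχm : Measurable fun y : Space => (locFun χ ℓ u y : ℂ) := by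
    unfold locFun
    exact Complex.measurable_ofReal.comp (hχ.continuous.measurable.comp (measurable_const_smul _ |>.comp
      (measurable_id.sub measurable_const)))
  have hχb : ∀ y : Space, ‖(locFun χ ℓ u y : ℂ)‖ ≤ Cχ := fun y => by
    rw [Complex.norm_real]; exact hCχ _
  have hQQm : Measurable (nbodyQ ℓ u j (nbodyQ ℓ u i Φ)) := measurable_nbodyQ ℓ u j (measurable_nbodyQ ℓ u i hΦm)
  have hQQ2 : MemLp (nbodyQ ℓ u j (nbodyQ ℓ u i Φ)) 2 μ :=
    memLp_nbodyQ hℓ j (measurable_nbodyQ ℓ u i hΦm) (memLp_nbodyQ hℓ i hΦm hΦ2)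
  have hMm : Measurable Mf := (measurable_comp_eval hχm i).mul ((measurable_comp_eval hχm j).mul hQQm)
  have hM2 : MemLp Mf 2 μ := memLp_mul hχm hχb i (memLp_mul hχm hχb j hQQ2)
  have hM0 : ∀ X y, y ∉ slidingBox ℓ u → Mf (Function.update X i y) = 0 := fun X y hy => by
    simp only [hMf, Function.update_self, locFun_eq_zero_of_not_mem hχ hℓ hy, Complex.ofReal_zero, zero_mul]
  set K : Config (m + 1) → ℂ := fun X => conj (A X) * Mf X with hK
  have hKm : Measurable K := (Complex.continuous_conj.measurable.comp hAm).mul hMm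
  have hKi : Integrable K μ := integrable_conj_mul hA2 hM2
  have hK0 : ∀ X y, y ∉ slidingBox ℓ u → K (Function.update X i y) = 0 := fun X y hy => by
    simp only [hK, hM0 X y hy, mul_zero]
  -- the marginal `G ∈ L¹ ∩ L²`
  set G : Space → ℂ := fun z => ((ℓ ^ 3)⁻¹ : ℝ) • ∫ X in boxConfig (m + 1) ℓ u, K (Function.update X i (z + X j))
    with hG
  have hGi : Integrable G := integrable_marginal i j hKm hKi hK0
  have hG2 : MemLp G 2 volume := by
    refine memLp_two_of_lintegral_ne_top hGi.aestronglyMeasurable ?_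
    have hle := lintegral_enorm_sq_marginal_le hℓ i j hAm hAu hMm hM0 (u := u)
    simp only [← enorm_eq_nnnorm]
    refine ne_top_of_le_ne_top ?_ hle
    refine ENNReal.mul_ne_top (ENNReal.mul_ne_top (ENNReal.inv_ne_top.2 (pow_ne_zero _ ?_)) ?_) ?_
    · rwa [Ne, ENNReal.ofReal_eq_zero, not_le]
    · simpa only [enorm_eq_nnnorm] using lintegral_ne_top_of_memLp_two hA2
    · simpa only [enorm_eq_nnnorm] using lintegral_ne_top_of_memLp_two hM2
  -- its Fourier transform is `S`
  have hFG : ∀ p : Space, 𝓕 G p = ∫ X in boxConfig (m + 1) ℓ u, conj (nbodyP ℓ u i (nbodyP ℓ u j Φ) X) *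
      (conj (locWave χ ℓ u p (X i)) * locWave χ ℓ u p (X j)) * nbodyQ ℓ u j (nbodyQ ℓ u i Φ) X := by
    intro p
    rw [hG, fourier_marginal_eq hℓ hij hKm hKi hK0 p]
    refine integral_congr_ae (Eventually.of_forall fun X => ?_)
    simp only [hK, hMf, hA, conj_locWave_mul_locWave']
    ring
  -- the bounded potential `U ∈ L¹ ∩ L²`
  have hUm' : Measurable fun x : Space => (U x : ℂ) := Complex.measurable_ofReal.comp hUm
  have hUb' : ∀ x : Space, ‖(U x : ℂ)‖ ≤ M := fun x => by rw [Complex.norm_real, Real.norm_eq_abs]; exact hUb x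
  have hUi' : Integrable (fun x : Space => (U x : ℂ)) := hUi.ofReal
  have hU2 : MemLp (fun x : Space => (U x : ℂ)) 2 volume :=
    Literature.Analysis.FluidPDE.memLp_two_of_integrable_of_bound hUi' hUb'
  -- integrability of `𝓕U · S`
  have hFU2 : MemLp (𝓕 (fun x : Space => (U x : ℂ))) 2 volume :=
    Literature.Analysis.FunctionSpaces.memLp_two_fourierIntegral hUi' hU2
  have hFG2 : MemLp (𝓕 G) 2 volume := Literature.Analysis.FunctionSpaces.memLp_two_fourierIntegral hGi hG2
  have hI0 : Integrable (fun p : Space => conj (𝓕 (fun x : Space => (U x : ℂ)) p) * 𝓕 G p) :=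
    integrable_conj_mul hFU2 hFG2
  have hconj : ∀ p : Space, conj (𝓕 (fun x : Space => (U x : ℂ)) p) = 𝓕 (fun x : Space => (U x : ℂ)) p :=
    fun p => conj_fourier_ofReal_even hUe p
  have hI : Integrable (fun p : Space => 𝓕 (fun x : Space => (U x : ℂ)) p * 𝓕 G p) := by
    refine hI0.congr (Eventually.of_forall fun p => ?_)
    simp only [hconj]
  refine ⟨?_, ?_⟩
  · refine hI.congr (Eventually.of_forall fun p => ?_)
    simp only [hFG]
    rfl
  -- Parseval, polarised (real part)
  have hP := Literature.Analysis.FluidPDE.re_integral_conj_fourier_mul_eq hUi' hU2 hGi hG2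
  simp only [hconj, Complex.conj_ofReal] at hP
  have hlhs : ∫ x : Space, (U x : ℂ) * G x = ∫ X in boxConfig (m + 1) ℓ u, (U (X i - X j) : ℂ) * K X :=
    (integral_mul_sub_eq_integral_marginal hℓ hij hKm hKi hK0 hUm' hUb').symm
  rw [hlhs] at hP
  simp only [hFG] at hP
  rw [hP]

/-- **(2.29) for a bounded even potential, summed over the pairs**: `∫ 𝓕U(p) Re⟨b_p†Φ, b_{-p}Φ⟩ dp`
converges absolutely and equals `∑_{i≠j} Re∫_{Λⁿ⁺¹} U(xᵢ - xⱼ) χ_Λ(xᵢ)χ_Λ(xⱼ) conj(PᵢPⱼΦ) QⱼQᵢΦ dX`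
(`∑_{i≠j} S_{ij}(p) = ⟨b_p†Φ, b_{-p}Φ⟩`, `integral_conj_bDagVec_mul_bVec`; `𝓕U` is real).
[cite: Fournais2020, (2.29)] -/
theorem sum_re_integral_pairPotential_eq (hχ : IsLocalizationFunction χ) (hℓ : 0 < ℓ)
    {Φ : Config (m + 1) → ℂ} (hΦm : Measurable Φ)
    (hΦ2 : MemLp Φ 2 ((volume : Measure (Config (m + 1))).restrict (boxConfig (m + 1) ℓ u)))
    {U : Space → ℝ} (hUm : Measurable U) (hUe : ∀ x, U (-x) = U x) {M : ℝ} (hUb : ∀ x, |U x| ≤ M)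
    (hUi : Integrable U) :
    Integrable (fun p : Space => (𝓕 (fun x : Space => (U x : ℂ)) p).re * pairingRe χ ℓ u p Φ) ∧
      ∑ i : Fin (m + 1), ∑ j : Fin (m + 1) with j ≠ i,
          (∫ X in boxConfig (m + 1) ℓ u, (U (X i - X j) : ℂ) *
            (conj (nbodyP ℓ u i (nbodyP ℓ u j Φ) X) *
              ((locFun χ ℓ u (X i) : ℂ) * ((locFun χ ℓ u (X j) : ℂ) * nbodyQ ℓ u j (nbodyQ ℓ u i Φ) X)))).re =
        ∫ p : Space, (𝓕 (fun x : Space => (U x : ℂ)) p).re * pairingRe χ ℓ u p Φ := by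
  set FU : Space → ℂ := 𝓕 (fun x : Space => (U x : ℂ)) with hFU
  set S : Fin (m + 1) → Fin (m + 1) → Space → ℂ := fun i j p =>
    ∫ X in boxConfig (m + 1) ℓ u, conj (nbodyP ℓ u i (nbodyP ℓ u j Φ) X) *
      (conj (locWave χ ℓ u p (X i)) * locWave χ ℓ u p (X j)) * nbodyQ ℓ u j (nbodyQ ℓ u i Φ) X with hS
  have hpair : ∀ i j : Fin (m + 1), j ≠ i → Integrable (fun p => FU p * S i j p) ∧
      (∫ X in boxConfig (m + 1) ℓ u, (U (X i - X j) : ℂ) *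
          (conj (nbodyP ℓ u i (nbodyP ℓ u j Φ) X) *
            ((locFun χ ℓ u (X i) : ℂ) * ((locFun χ ℓ u (X j) : ℂ) * nbodyQ ℓ u j (nbodyQ ℓ u i Φ) X)))).re =
        (∫ p, FU p * S i j p).re :=
    fun i j hji => re_integral_pairPotential_eq hχ hℓ (Ne.symm hji) hΦm hΦ2 hUm hUe hUb hUi
  -- the sum of the `S_{ij}` is the pairing `⟨b_p†Φ, b_{-p}Φ⟩`
  have hsum : ∀ p : Space, ∑ i : Fin (m + 1), ∑ j : Fin (m + 1) with j ≠ i, FU p * S i j p =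
      FU p * ∫ X in boxConfig (m + 1) ℓ u, conj (bDagVec χ ℓ u p Φ X) * bVec χ ℓ u (-p) Φ X := by
    intro p
    rw [integral_conj_bDagVec_mul_bVec hχ hℓ u p hΦm hΦ2, Finset.mul_sum]
    refine Finset.sum_congr rfl fun i _ => ?_
    rw [Finset.mul_sum]
  have hIij : ∀ i : Fin (m + 1), ∀ j ∈ (Finset.univ.filter fun j : Fin (m + 1) => j ≠ i),
      Integrable (fun p => FU p * S i j p) := fun i j hj => (hpair i j (Finset.mem_filter.1 hj).2).1
  have hIi : ∀ i ∈ (Finset.univ : Finset (Fin (m + 1))),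
      Integrable (fun p => ∑ j : Fin (m + 1) with j ≠ i, FU p * S i j p) := fun i _ =>
    integrable_finsetSum _ (hIij i)
  have hIsum : Integrable (fun p : Space =>
      FU p * ∫ X in boxConfig (m + 1) ℓ u, conj (bDagVec χ ℓ u p Φ X) * bVec χ ℓ u (-p) Φ X) := by
    refine (integrable_finsetSum _ hIi).congr (Eventually.of_forall fun p => ?_)
    exact hsum p
  have hre : ∀ p : Space, (FU p * ∫ X in boxConfig (m + 1) ℓ u, conj (bDagVec χ ℓ u p Φ X) * bVec χ ℓ u (-p) Φ X).re =
      (FU p).re * pairingRe χ ℓ u p Φ := fun p => by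
    rw [hFU, re_fourier_ofReal_even_mul hUe]
    rfl
  refine ⟨(hIsum.re).congr (Eventually.of_forall fun p => ?_), ?_⟩
  · simp only [RCLike.re_to_complex]
    exact hre p
  calc ∑ i : Fin (m + 1), ∑ j : Fin (m + 1) with j ≠ i,
        (∫ X in boxConfig (m + 1) ℓ u, (U (X i - X j) : ℂ) *
          (conj (nbodyP ℓ u i (nbodyP ℓ u j Φ) X) *
            ((locFun χ ℓ u (X i) : ℂ) * ((locFun χ ℓ u (X j) : ℂ) * nbodyQ ℓ u j (nbodyQ ℓ u i Φ) X)))).re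
      = ∑ i : Fin (m + 1), ∑ j : Fin (m + 1) with j ≠ i, (∫ p, FU p * S i j p).re :=
        Finset.sum_congr rfl fun i _ => Finset.sum_congr rfl fun j hj => (hpair i j (Finset.mem_filter.1 hj).2).2
    _ = (∑ i : Fin (m + 1), ∑ j : Fin (m + 1) with j ≠ i, ∫ p, FU p * S i j p).re := by
        rw [Complex.re_sum]
        exact Finset.sum_congr rfl fun i _ => (Complex.re_sum _ _).symm
    _ = (∫ p, ∑ i : Fin (m + 1), ∑ j : Fin (m + 1) with j ≠ i, FU p * S i j p).re := by
        rw [integral_finsetSum _ hIi]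
        congr 1
        exact Finset.sum_congr rfl fun i hi => (integral_finsetSum _ (hIij i)).symm
    _ = (∫ p, FU p * ∫ X in boxConfig (m + 1) ℓ u, conj (bDagVec χ ℓ u p Φ X) * bVec χ ℓ u (-p) Φ X).re := by
        congr 1
        exact integral_congr_ae (Eventually.of_forall hsum)
    _ = ∫ p, (FU p * ∫ X in boxConfig (m + 1) ℓ u, conj (bDagVec χ ℓ u p Φ X) * bVec χ ℓ u (-p) Φ X).re := by
        have h := integral_re hIsum
        simp only [RCLike.re_to_complex] at h
        exact h.symm
    _ = ∫ p, (FU p).re * pairingRe χ ℓ u p Φ := integral_congr_ae (Eventually.of_forall hre)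

end Pair

/-! ### The momentum side: a weighted Cauchy–Schwarz bound -/

section Momentum

variable {m : ℕ} {χ : Space → ℝ} {ℓ : ℝ} {u : Space}

/-- Lebesgue measure on `ℝ³` does not see the origin (local copy of the helper of
`PeriodicBoseGasEq229Bdd.lean`, kept private to keep the import closure small). [folklore] -/
private theorem volume_ae_ne_zero : ∀ᵐ p ∂(volume : Measure Space), p ≠ 0 := by
  have h : (volume : Measure Space) {0} = 0 := measure_singleton 0
  rw [ae_iff]
  simp only [ne_eq, not_not, setOf_eq_eq_singleton]
  exact h

/-- **Weighted Cauchy–Schwarz on the momentum side**: for `f ∈ L¹(ℝ³)` real and `Φ` on `Λ(u)ⁿ⁺¹`,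
`∫ |𝓕f(p)| |Re⟨b_p†Φ, b_{-p}Φ⟩| dp ≤ sup_p‖b_p†Φ‖ · (∫|𝓕f|²/(4π²p²))^{1/2} · (∫4π²p²‖b_{-p}Φ‖²)^{1/2}`
(`‖b_p†Φ‖² ≤ (n+1)²(2sup|χ|)²‖Φ‖²`). [cite: Fournais2020, (2.28)–(2.30), (2.42)] -/
theorem lintegral_enorm_fourier_mul_pairingRe_le (hχ : IsLocalizationFunction χ) {Cχ : ℝ} (hCχ : ∀ x, ‖χ x‖ ≤ Cχ)
    (hℓ : 0 < ℓ) (u : Space) {Φ : Config (m + 1) → ℂ} (hΦm : Measurable Φ) {f : Space → ℝ} (hfi : Integrable f) :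
    ∫⁻ p : Space, ‖𝓕 (fun x : Space => (f x : ℂ)) p‖ₑ * ‖pairingRe χ ℓ u p Φ‖ₑ ≤
      (ENNReal.ofReal (((m + 1 : ℕ) : ℝ) * (2 * Cχ) ^ 2) * (m + 1 : ℕ) *
          ∫⁻ X in boxConfig (m + 1) ℓ u, ((‖Φ X‖₊ : ℝ≥0∞)) ^ 2) ^ (1 / 2 : ℝ) *
        ((∫⁻ p : Space, ENNReal.ofReal (‖𝓕 (fun x : Space => (f x : ℂ)) p‖ ^ 2 * ((2 * Real.pi) ^ 2 * ‖p‖ ^ 2)⁻¹)) ^ (1 / 2 : ℝ) *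
          (∫⁻ p : Space, ENNReal.ofReal ((2 * Real.pi) ^ 2 * ‖p‖ ^ 2) *
            ∫⁻ X in boxConfig (m + 1) ℓ u, ((‖bVec χ ℓ u (-p) Φ X‖₊ : ℝ≥0∞)) ^ 2) ^ (1 / 2 : ℝ)) := by
  set D2 : ℝ≥0∞ := ENNReal.ofReal (((m + 1 : ℕ) : ℝ) * (2 * Cχ) ^ 2) * (m + 1 : ℕ) *
    ∫⁻ X in boxConfig (m + 1) ℓ u, ((‖Φ X‖₊ : ℝ≥0∞)) ^ 2 with hD2
  set Nb : Space → ℝ≥0∞ := fun p => ∫⁻ X in boxConfig (m + 1) ℓ u, ((‖bVec χ ℓ u (-p) Φ X‖₊ : ℝ≥0∞)) ^ 2 with hNb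
  set F : Space → ℂ := 𝓕 (fun x : Space => (f x : ℂ)) with hF
  have hFc : Continuous F := Literature.Analysis.FluidPDE.FourierNS.continuous_fourierIntegral hfi.ofReal
  have hNbm : Measurable Nb := measurable_lintegral_normSq_bVec_neg hχ.continuous ℓ u hΦm
  -- the pairing is bounded by `‖b_p†Φ‖‖b_{-p}Φ‖`
  have hpt : ∀ p : Space, ‖pairingRe χ ℓ u p Φ‖ₑ ≤ D2 ^ (1 / 2 : ℝ) * Nb p ^ (1 / 2 : ℝ) := by
    intro p
    have hbm : AEMeasurable (bVec χ ℓ u (-p) Φ) ((volume : Measure (Config (m + 1))).restrict (boxConfig (m + 1) ℓ u)) :=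
      ((measurable_bVec hχ.continuous ℓ u hΦm).comp (measurable_prodMk_right (y := -p))).aemeasurable
    have hdm : AEMeasurable (bDagVec χ ℓ u p Φ) ((volume : Measure (Config (m + 1))).restrict (boxConfig (m + 1) ℓ u)) :=
      (measurable_bDagVec hχ.continuous ℓ u p hΦm).aemeasurable
    calc ‖pairingRe χ ℓ u p Φ‖ₑ
        ≤ ‖∫ X in boxConfig (m + 1) ℓ u, conj (bDagVec χ ℓ u p Φ X) * bVec χ ℓ u (-p) Φ X‖ₑ := by
          rw [pairingRe, ← ofReal_norm, ← ofReal_norm, Real.norm_eq_abs]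
          exact ENNReal.ofReal_le_ofReal (Complex.abs_re_le_norm _)
      _ ≤ (∫⁻ X in boxConfig (m + 1) ℓ u, ((‖bDagVec χ ℓ u p Φ X‖₊ : ℝ≥0∞)) ^ 2) ^ (1 / 2 : ℝ) * Nb p ^ (1 / 2 : ℝ) :=
          enorm_integral_conj_mul_le _ hdm hbm
      _ ≤ D2 ^ (1 / 2 : ℝ) * Nb p ^ (1 / 2 : ℝ) := by
          gcongr
          exact lintegral_normSq_bDagVec_le hCχ hℓ u p hΦm
  -- factorisation through the weights, away from `p = 0`
  set a : Space → ℝ≥0∞ := fun p => ENNReal.ofReal (‖F p‖ ^ 2 * ((2 * Real.pi) ^ 2 * ‖p‖ ^ 2)⁻¹) with ha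
  set b : Space → ℝ≥0∞ := fun p => ENNReal.ofReal ((2 * Real.pi) ^ 2 * ‖p‖ ^ 2) * Nb p with hb
  have hab : ∀ p : Space, p ≠ 0 → ‖F p‖ₑ * Nb p ^ (1 / 2 : ℝ) = a p ^ (1 / 2 : ℝ) * b p ^ (1 / 2 : ℝ) := by
    intro p hp
    have hp' : ‖p‖ ≠ 0 := norm_ne_zero_iff.2 hp
    have hw : (2 * Real.pi) ^ 2 * ‖p‖ ^ 2 ≠ 0 := by positivity
    rw [← ENNReal.mul_rpow_of_nonneg _ _ (by norm_num : (0 : ℝ) ≤ 1 / 2), ha, hb, ← mul_assoc,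
      ← ENNReal.ofReal_mul (by positivity), inv_mul_cancel_right₀ hw,
      ENNReal.mul_rpow_of_nonneg _ _ (by norm_num : (0 : ℝ) ≤ 1 / 2)]
    congr 1
    rw [ENNReal.ofReal_pow (norm_nonneg _), ofReal_norm, ← ENNReal.rpow_natCast, ← ENNReal.rpow_mul]
    norm_num
  have hae : ∀ᵐ p ∂(volume : Measure Space),
      ‖F p‖ₑ * ‖pairingRe χ ℓ u p Φ‖ₑ ≤ D2 ^ (1 / 2 : ℝ) * (a p ^ (1 / 2 : ℝ) * b p ^ (1 / 2 : ℝ)) := by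
    filter_upwards [volume_ae_ne_zero] with p hp
    calc ‖F p‖ₑ * ‖pairingRe χ ℓ u p Φ‖ₑ ≤ ‖F p‖ₑ * (D2 ^ (1 / 2 : ℝ) * Nb p ^ (1 / 2 : ℝ)) :=
          mul_le_mul_right (hpt p) _
      _ = D2 ^ (1 / 2 : ℝ) * (‖F p‖ₑ * Nb p ^ (1 / 2 : ℝ)) := by ring
      _ = D2 ^ (1 / 2 : ℝ) * (a p ^ (1 / 2 : ℝ) * b p ^ (1 / 2 : ℝ)) := by rw [hab p hp]
  -- Hölder
  have ham : Measurable a := by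
    rw [ha]
    exact ENNReal.measurable_ofReal.comp ((hFc.norm.measurable.pow_const 2).mul
      ((measurable_const.mul (measurable_norm.pow_const 2)).inv))
  have hbm : Measurable b := by
    rw [hb]
    exact (ENNReal.measurable_ofReal.comp (by fun_prop)).mul hNbm
  have hH := ENNReal.lintegral_mul_le_Lp_mul_Lq (volume : Measure Space) Real.HolderConjugate.two_two
    (ham.pow_const (1 / 2 : ℝ)).aemeasurable (hbm.pow_const (1 / 2 : ℝ)).aemeasurable
  have hH' : ∫⁻ p, a p ^ (1 / 2 : ℝ) * b p ^ (1 / 2 : ℝ) ≤ (∫⁻ p, a p) ^ (1 / 2 : ℝ) * (∫⁻ p, b p) ^ (1 / 2 : ℝ) := by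
    have e : ∀ x : ℝ≥0∞, (x ^ (1 / 2 : ℝ)) ^ (2 : ℝ) = x := fun x => by
      rw [← ENNReal.rpow_mul]; norm_num
    simpa only [Pi.mul_apply, e] using hH
  have hmeas : Measurable fun p => a p ^ (1 / 2 : ℝ) * b p ^ (1 / 2 : ℝ) :=
    (ham.pow_const _).mul (hbm.pow_const _)
  calc ∫⁻ p : Space, ‖F p‖ₑ * ‖pairingRe χ ℓ u p Φ‖ₑ
      ≤ ∫⁻ p, D2 ^ (1 / 2 : ℝ) * (a p ^ (1 / 2 : ℝ) * b p ^ (1 / 2 : ℝ)) := lintegral_mono_ae hae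
    _ = D2 ^ (1 / 2 : ℝ) * ∫⁻ p, a p ^ (1 / 2 : ℝ) * b p ^ (1 / 2 : ℝ) := lintegral_const_mul _ hmeas
    _ ≤ D2 ^ (1 / 2 : ℝ) * ((∫⁻ p, a p) ^ (1 / 2 : ℝ) * (∫⁻ p, b p) ^ (1 / 2 : ℝ)) := mul_le_mul_right hH' _
    _ = _ := by simp only [ha, hb]

/-- **The limiting momentum integrand is integrable**: `𝓕f · Re⟨b_p†Φ, b_{-p}Φ⟩ ∈ L¹(dp)` as soon as
`‖Φ‖ < ∞`, the Coulomb energy `∫|𝓕f|²/(4π²p²)` is finite and `∫4π²p²‖b_{-p}Φ‖² < ∞`.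
[cite: Fournais2020, (2.29)] -/
theorem integrable_re_fourier_mul_pairingRe (hχ : IsLocalizationFunction χ) {Cχ : ℝ} (hCχ : ∀ x, ‖χ x‖ ≤ Cχ)
    (hℓ : 0 < ℓ) (u : Space) {Φ : Config (m + 1) → ℂ} (hΦm : Measurable Φ) {f : Space → ℝ} (hfi : Integrable f)
    (hN2 : (∫⁻ X in boxConfig (m + 1) ℓ u, ((‖Φ X‖₊ : ℝ≥0∞)) ^ 2) ≠ ⊤)
    (hCoul : (∫⁻ p : Space, ENNReal.ofReal
      (‖𝓕 (fun x : Space => (f x : ℂ)) p‖ ^ 2 * ((2 * Real.pi) ^ 2 * ‖p‖ ^ 2)⁻¹)) ≠ ⊤)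
    (hBk : (∫⁻ p : Space, ENNReal.ofReal ((2 * Real.pi) ^ 2 * ‖p‖ ^ 2) *
      ∫⁻ X in boxConfig (m + 1) ℓ u, ((‖bVec χ ℓ u (-p) Φ X‖₊ : ℝ≥0∞)) ^ 2) ≠ ⊤) :
    Integrable (fun p : Space => (𝓕 (fun x : Space => (f x : ℂ)) p).re * pairingRe χ ℓ u p Φ) := by
  have hFc : Continuous (𝓕 (fun x : Space => (f x : ℂ))) :=
    Literature.Analysis.FluidPDE.FourierNS.continuous_fourierIntegral hfi.ofReal
  refine ⟨((Complex.continuous_re.comp hFc).measurable.mul (measurable_pairingRe hχ ℓ u hΦm)).aestronglyMeasurable, ?_⟩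
  have hle := lintegral_enorm_fourier_mul_pairingRe_le hχ hCχ hℓ u hΦm hfi
  have hD2 : ENNReal.ofReal (((m + 1 : ℕ) : ℝ) * (2 * Cχ) ^ 2) * (m + 1 : ℕ) *
      ∫⁻ X in boxConfig (m + 1) ℓ u, ((‖Φ X‖₊ : ℝ≥0∞)) ^ 2 ≠ ⊤ :=
    ENNReal.mul_ne_top (ENNReal.mul_ne_top ENNReal.ofReal_ne_top (ENNReal.natCast_ne_top _)) hN2
  unfold HasFiniteIntegral
  calc ∫⁻ p : Space, ‖(𝓕 (fun x : Space => (f x : ℂ)) p).re * pairingRe χ ℓ u p Φ‖ₑ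
      ≤ ∫⁻ p : Space, ‖𝓕 (fun x : Space => (f x : ℂ)) p‖ₑ * ‖pairingRe χ ℓ u p Φ‖ₑ := by
        refine lintegral_mono fun p => ?_
        rw [enorm_mul]
        gcongr
        rw [← ofReal_norm, ← ofReal_norm, Real.norm_eq_abs]
        exact ENNReal.ofReal_le_ofReal (Complex.abs_re_le_norm _)
    _ ≤ _ := hle
    _ < ⊤ := ENNReal.mul_lt_top (ENNReal.rpow_lt_top_of_nonneg (by norm_num : (0 : ℝ) ≤ 1 / 2) hD2)
        (ENNReal.mul_lt_top (ENNReal.rpow_lt_top_of_nonneg (by norm_num : (0 : ℝ) ≤ 1 / 2) hCoul)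
          (ENNReal.rpow_lt_top_of_nonneg (by norm_num : (0 : ℝ) ≤ 1 / 2) hBk))

/-- The Fourier integral is linear: `𝓕f - 𝓕g = 𝓕(f - g)` for integrable real `f, g`. [folklore] -/
theorem fourier_ofReal_sub {f g : Space → ℝ} (hfi : Integrable f) (hgi : Integrable g) (p : Space) :
    𝓕 (fun x : Space => (f x : ℂ)) p - 𝓕 (fun x : Space => (g x : ℂ)) p =
      𝓕 (fun x : Space => ((f x - g x : ℝ) : ℂ)) p := by
  simp only [Real.fourier_eq, Complex.ofReal_sub, smul_sub]
  rw [integral_sub ((Real.fourierIntegral_convergent_iff p).2 hfi.ofReal)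
    ((Real.fourierIntegral_convergent_iff p).2 hgi.ofReal)]

/-- **The momentum integrals of two potentials differ by at most**
`sup‖b_p†Φ‖ · (Coulomb energy of f - g)^{1/2} · (∫4π²p²‖b_{-p}Φ‖²)^{1/2}`. [cite: Fournais2020, (2.29), (2.42)] -/
theorem enorm_integral_re_fourier_mul_pairingRe_sub_le (hχ : IsLocalizationFunction χ) {Cχ : ℝ}
    (hCχ : ∀ x, ‖χ x‖ ≤ Cχ) (hℓ : 0 < ℓ) (u : Space) {Φ : Config (m + 1) → ℂ} (hΦm : Measurable Φ)
    {f g : Space → ℝ} (hfi : Integrable f) (hgi : Integrable g)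
    (hIf : Integrable (fun p : Space => (𝓕 (fun x : Space => (f x : ℂ)) p).re * pairingRe χ ℓ u p Φ))
    (hIg : Integrable (fun p : Space => (𝓕 (fun x : Space => (g x : ℂ)) p).re * pairingRe χ ℓ u p Φ)) :
    ‖(∫ p : Space, (𝓕 (fun x : Space => (f x : ℂ)) p).re * pairingRe χ ℓ u p Φ) -
        ∫ p : Space, (𝓕 (fun x : Space => (g x : ℂ)) p).re * pairingRe χ ℓ u p Φ‖ₑ ≤
      (ENNReal.ofReal (((m + 1 : ℕ) : ℝ) * (2 * Cχ) ^ 2) * (m + 1 : ℕ) *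
          ∫⁻ X in boxConfig (m + 1) ℓ u, ((‖Φ X‖₊ : ℝ≥0∞)) ^ 2) ^ (1 / 2 : ℝ) *
        ((∫⁻ p : Space, ENNReal.ofReal (‖𝓕 (fun x : Space => ((f x - g x : ℝ) : ℂ)) p‖ ^ 2 *
            ((2 * Real.pi) ^ 2 * ‖p‖ ^ 2)⁻¹)) ^ (1 / 2 : ℝ) *
          (∫⁻ p : Space, ENNReal.ofReal ((2 * Real.pi) ^ 2 * ‖p‖ ^ 2) *
            ∫⁻ X in boxConfig (m + 1) ℓ u, ((‖bVec χ ℓ u (-p) Φ X‖₊ : ℝ≥0∞)) ^ 2) ^ (1 / 2 : ℝ)) := by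
  rw [← integral_sub hIf hIg]
  have hpt : ∀ p : Space, (𝓕 (fun x : Space => (f x : ℂ)) p).re * pairingRe χ ℓ u p Φ -
      (𝓕 (fun x : Space => (g x : ℂ)) p).re * pairingRe χ ℓ u p Φ =
      (𝓕 (fun x : Space => ((f x - g x : ℝ) : ℂ)) p).re * pairingRe χ ℓ u p Φ := fun p => by
    rw [← sub_mul, ← Complex.sub_re, fourier_ofReal_sub hfi hgi]
  simp only [hpt]
  calc ‖∫ p : Space, (𝓕 (fun x : Space => ((f x - g x : ℝ) : ℂ)) p).re * pairingRe χ ℓ u p Φ‖ₑ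
      ≤ ∫⁻ p : Space, ‖(𝓕 (fun x : Space => ((f x - g x : ℝ) : ℂ)) p).re * pairingRe χ ℓ u p Φ‖ₑ :=
        enorm_integral_le_lintegral_enorm _
    _ ≤ ∫⁻ p : Space, ‖𝓕 (fun x : Space => ((f x - g x : ℝ) : ℂ)) p‖ₑ * ‖pairingRe χ ℓ u p Φ‖ₑ := by
        refine lintegral_mono fun p => ?_
        rw [enorm_mul]
        gcongr
        rw [← ofReal_norm, ← ofReal_norm, Real.norm_eq_abs]
        exact ENNReal.ofReal_le_ofReal (Complex.abs_re_le_norm _)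
    _ ≤ _ := lintegral_enorm_fourier_mul_pairingRe_le hχ hCχ hℓ u hΦm (hfi.sub hgi)

/-- **`∫ 4π²p² ‖b_{-p}Φ‖² dp < ∞` on the form domain**: by (2.30) (`lintegral_tau_normSq_bVec_le`) and
(2.32) (`lintegral_lintegral_normSq_bVec_le`), `4π²p² ≤ τ(p) + (sℓ)⁻²`. [cite: Fournais2020, (2.30), (2.32)] -/
theorem lintegral_weight_normSq_bVec_ne_top {n : ℕ} (hχc : Continuous χ) {Cχ : ℝ} (hCχ : ∀ x, ‖χ x‖ ≤ Cχ)
    (hℓ : 0 < ℓ) (s : ℝ) (u : Space) {Φ : Config n → ℂ} (hΦm : Measurable Φ)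
    (hT : kinExcForm χ ℓ s u Φ ≠ ⊤) (hNP : nPlusBoxN ℓ u Φ ≠ ⊤) :
    (∫⁻ p : Space, ENNReal.ofReal ((2 * Real.pi) ^ 2 * ‖p‖ ^ 2) *
      ∫⁻ X in boxConfig n ℓ u, ((‖bVec χ ℓ u (-p) Φ X‖₊ : ℝ≥0∞)) ^ 2) ≠ ⊤ := by
  set Nb : Space → ℝ≥0∞ := fun p => ∫⁻ X in boxConfig n ℓ u, ((‖bVec χ ℓ u p Φ X‖₊ : ℝ≥0∞)) ^ 2 with hNb
  have hNbm : Measurable Nb := measurable_lintegral_normSq_bVec hχc ℓ u hΦm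
  have h1 : ∫⁻ p : Space, ENNReal.ofReal ((2 * Real.pi) ^ 2 * ‖p‖ ^ 2) * Nb (-p) =
      ∫⁻ p : Space, ENNReal.ofReal ((2 * Real.pi) ^ 2 * ‖p‖ ^ 2) * Nb p := by
    have h := lintegral_neg_eq_self (μ := (volume : Measure Space))
      (fun p : Space => ENNReal.ofReal ((2 * Real.pi) ^ 2 * ‖p‖ ^ 2) * Nb p)
    simpa only [norm_neg] using h
  have h2 : ∀ p : Space, ENNReal.ofReal ((2 * Real.pi) ^ 2 * ‖p‖ ^ 2) ≤
      ENNReal.ofReal (4 * Real.pi ^ 2 * ‖p‖ ^ 2 - (s * ℓ)⁻¹ ^ 2) + ENNReal.ofReal ((s * ℓ)⁻¹ ^ 2) := fun p => by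
    calc ENNReal.ofReal ((2 * Real.pi) ^ 2 * ‖p‖ ^ 2)
        = ENNReal.ofReal ((4 * Real.pi ^ 2 * ‖p‖ ^ 2 - (s * ℓ)⁻¹ ^ 2) + (s * ℓ)⁻¹ ^ 2) := by congr 1; ring
      _ ≤ _ := ENNReal.ofReal_add_le
  have h230 := lintegral_tau_normSq_bVec_le hχc hℓ s u hΦm (Φ := Φ)
  have h232 := lintegral_lintegral_normSq_bVec_le hχc hCχ hℓ u hΦm (Φ := Φ)
  change ∫⁻ p : Space, ENNReal.ofReal ((2 * Real.pi) ^ 2 * ‖p‖ ^ 2) * Nb (-p) ≠ ⊤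
  rw [h1]
  have hℓ3 : (ENNReal.ofReal ℓ ^ 3)⁻¹ ≠ ⊤ :=
    ENNReal.inv_ne_top.2 (pow_ne_zero _ (by rwa [Ne, ENNReal.ofReal_eq_zero, not_le]))
  have hbound : ∫⁻ p : Space, ENNReal.ofReal ((2 * Real.pi) ^ 2 * ‖p‖ ^ 2) * Nb p ≤
      n * (ENNReal.ofReal ℓ ^ 3)⁻¹ * kinExcForm χ ℓ s u Φ +
        ENNReal.ofReal ((s * ℓ)⁻¹ ^ 2) * (ENNReal.ofReal (Cχ ^ 2) * n * (ENNReal.ofReal ℓ ^ 3)⁻¹ * nPlusBoxN ℓ u Φ) := by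
    calc ∫⁻ p : Space, ENNReal.ofReal ((2 * Real.pi) ^ 2 * ‖p‖ ^ 2) * Nb p
        ≤ ∫⁻ p : Space, (ENNReal.ofReal (4 * Real.pi ^ 2 * ‖p‖ ^ 2 - (s * ℓ)⁻¹ ^ 2) +
            ENNReal.ofReal ((s * ℓ)⁻¹ ^ 2)) * Nb p := lintegral_mono fun p => mul_le_mul_left (h2 p) (Nb p)
      _ = (∫⁻ p : Space, ENNReal.ofReal (4 * Real.pi ^ 2 * ‖p‖ ^ 2 - (s * ℓ)⁻¹ ^ 2) * Nb p) +
            ∫⁻ p : Space, ENNReal.ofReal ((s * ℓ)⁻¹ ^ 2) * Nb p := by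
          simp_rw [add_mul]
          exact lintegral_add_left ((ENNReal.measurable_ofReal.comp (by fun_prop)).mul hNbm) _
      _ ≤ _ := by
          refine add_le_add h230 ?_
          rw [lintegral_const_mul' _ _ ENNReal.ofReal_ne_top]
          exact mul_le_mul_right h232 _
  refine ne_top_of_le_ne_top ?_ hbound
  exact ENNReal.add_ne_top.2 ⟨ENNReal.mul_ne_top (ENNReal.mul_ne_top (ENNReal.natCast_ne_top _) hℓ3) hT,
    ENNReal.mul_ne_top ENNReal.ofReal_ne_top (ENNReal.mul_ne_top (ENNReal.mul_ne_top
      (ENNReal.mul_ne_top ENNReal.ofReal_ne_top (ENNReal.natCast_ne_top _)) hℓ3) hNP)⟩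

end Momentum

/-! ### The Coulomb energy of the truncation tails tends to zero -/

section Coulomb

/-- **`∫|𝓕(W - min(W,N))|²/(4π²p²) dp → 0`** for `0 ≤ W ∈ L¹(ℝ³)` of finite Coulomb energy: in position
space (`lintegral_normSq_fourier_div_eq`) this is `∬f_N(x)f_N(y)/(4π|x-y|) → 0` for `f_N = (W - N)₊ ↓ 0`,
dominated by `W(x)W(y)/(4π|x-y|) ∈ L¹`. [cite: Fournais2020, (2.42)] -/
theorem tendsto_coulomb_truncation {W : Space → ℝ} (hWm : Measurable W) (hW0 : ∀ x, 0 ≤ W x) (hWi : Integrable W)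
    (hfin : (∫⁻ x : Space, ∫⁻ y : Space, ENNReal.ofReal (W x * W y * (4 * Real.pi * ‖x - y‖)⁻¹)) ≠ ⊤) :
    Tendsto (fun N : ℕ => ∫⁻ p : Space, ENNReal.ofReal
        (‖𝓕 (fun x : Space => ((W x - min (W x) N : ℝ) : ℂ)) p‖ ^ 2 * ((2 * Real.pi) ^ 2 * ‖p‖ ^ 2)⁻¹))
      atTop (𝓝 0) := by
  set k : Space → Space → ℝ := fun x y => (4 * Real.pi * ‖x - y‖)⁻¹ with hk
  have hk0 : ∀ x y, 0 ≤ k x y := fun x y => by positivity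
  have hkm : Measurable fun q : Space × Space => k q.1 q.2 :=
    (measurable_const.mul (measurable_fst.sub measurable_snd).norm).inv
  set fN : ℕ → Space → ℝ := fun N x => W x - min (W x) N with hfN
  have hfN0 : ∀ N x, 0 ≤ fN N x := fun N x => sub_nonneg.2 (min_le_left _ _)
  have hfNle : ∀ N x, fN N x ≤ W x := fun N x => sub_le_self _ (le_min (hW0 x) (Nat.cast_nonneg N))
  have hfNm : ∀ N, Measurable (fN N) := fun N => hWm.sub (hWm.min measurable_const)
  have hfNi : ∀ N, Integrable (fN N) := fun N =>
    hWi.mono' (hfNm N).aestronglyMeasurable (Eventually.of_forall fun x => by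
      rw [Real.norm_of_nonneg (hfN0 N x)]; exact hfNle N x)
  have hfNt : ∀ x, Tendsto (fun N => fN N x) atTop (𝓝 0) := by
    intro x
    refine tendsto_const_nhds.congr' ?_
    filter_upwards [Filter.eventually_ge_atTop ⌈W x⌉₊] with N hN
    simp only [hfN]
    rw [min_eq_left ((Nat.le_ceil (W x)).trans (by exact_mod_cast hN)), sub_self]
  -- position space
  have heq : (fun N : ℕ => ∫⁻ p : Space, ENNReal.ofReal
      (‖𝓕 (fun x : Space => ((W x - min (W x) N : ℝ) : ℂ)) p‖ ^ 2 * ((2 * Real.pi) ^ 2 * ‖p‖ ^ 2)⁻¹)) =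
      fun N => ∫⁻ x : Space, ∫⁻ y : Space, ENNReal.ofReal (fN N x * fN N y * k x y) :=
    funext fun N => lintegral_normSq_fourier_div_eq (hfNm N) (hfNi N) (hfN0 N)
  rw [heq]
  -- the dominating kernel
  set Bd : Space → Space → ℝ≥0∞ := fun x y => ENNReal.ofReal (W x * W y * k x y) with hBd
  have hBdm : Measurable fun q : Space × Space => Bd q.1 q.2 :=
    ENNReal.measurable_ofReal.comp (((hWm.comp measurable_fst).mul (hWm.comp measurable_snd)).mul hkm)
  have hFNm : ∀ N, Measurable fun q : Space × Space => ENNReal.ofReal (fN N q.1 * fN N q.2 * k q.1 q.2) := fun N =>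
    ENNReal.measurable_ofReal.comp ((((hfNm N).comp measurable_fst).mul ((hfNm N).comp measurable_snd)).mul hkm)
  have hle : ∀ N x y, ENNReal.ofReal (fN N x * fN N y * k x y) ≤ Bd x y := fun N x y =>
    ENNReal.ofReal_le_ofReal (mul_le_mul_of_nonneg_right
      (mul_le_mul (hfNle N x) (hfNle N y) (hfN0 N y) (hW0 x)) (hk0 x y))
  -- inner dominated convergence, for a.e. `x`
  have hinner_fin : ∀ᵐ x : Space, ∫⁻ y, Bd x y < ⊤ := ae_lt_top hBdm.lintegral_prod_right' hfin
  have hinner : ∀ᵐ x : Space, Tendsto (fun N => ∫⁻ y, ENNReal.ofReal (fN N x * fN N y * k x y)) atTop (𝓝 0) := by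
    filter_upwards [hinner_fin] with x hx
    have h := tendsto_lintegral_of_dominated_convergence (Bd x)
      (fun N => (hFNm N).comp measurable_prodMk_left) (fun N => Eventually.of_forall fun y => hle N x y) hx.ne
      (Eventually.of_forall fun y => (?_ : Tendsto (fun N => ENNReal.ofReal (fN N x * fN N y * k x y)) atTop (𝓝 0)))
    · simpa only [lintegral_zero, Function.comp_def] using h
    · have h1 := ENNReal.tendsto_ofReal (((hfNt x).mul (hfNt y)).mul_const (k x y))
      simpa only [zero_mul, ENNReal.ofReal_zero] using h1
  -- outer dominated convergence
  have h := tendsto_lintegral_of_dominated_convergence (fun x => ∫⁻ y, Bd x y)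
    (fun N => (hFNm N).lintegral_prod_right') (fun N => Eventually.of_forall fun x => lintegral_mono fun y => hle N x y)
    hfin hinner
  simpa only [lintegral_zero] using h

end Coulomb

/-! ### Assembly: (2.29) on the form domain -/

section Assembly

/-- `w₁(x,y).toReal = χ_Λ(x) W₁(x-y).toReal χ_Λ(y)`. [cite: Fournais2020, (2.8)] -/
theorem toReal_pairLoc₁_eq {χ : Space → ℝ} (hχ : IsLocalizationFunction χ) (v : ℝ → ℝ≥0∞) (ω : Space → ℝ)
    (ℓ : ℝ) (u x y : Space) :
    (pairLoc₁ v ω χ ℓ u x y).toReal = locFun χ ℓ u x * (bigW₁ v ω χ ℓ (x - y)).toReal * locFun χ ℓ u y := by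
  unfold pairLoc₁
  rw [ENNReal.toReal_mul, ENNReal.toReal_mul, ENNReal.toReal_ofReal (locFun_nonneg hχ ℓ u x),
    ENNReal.toReal_ofReal (locFun_nonneg hχ ℓ u y)]

/-- **Fournais 2020, (2.29), proved on the form domain.** "A direct calculation gives
`A₂ = ½(2π)⁻³∫Ŵ₁(p)(b_p†b_{-p}† + b_pb_{-p})dp`": for every measurable `Φ` on `Λ(u)ⁿ` with finite norm,
finite repulsion `⟨Φ, ∑_{i<j}w(xᵢ,xⱼ)Φ⟩ < ∞` and finite kinetic form,
`⟨Φ, A₂Φ⟩ = ∫ Ŵ₁(p) Re⟨b_p†Φ, b_{-p}Φ⟩ dp` with the `p`-integral absolutely convergent (Mathlib's `𝓕`,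
`k = 2πp`; hypotheses on `v, ω, χ, C, R, ℓ, s, b` as in `Fournais2020_eq229`). This is the vendored
`Fournais2020_eq229` with the extra hypothesis of finite repulsion — the form domain of the box
Hamiltonian (2.6), on which `⟨Φ, A₂Φ⟩` is an absolutely convergent integral; it is the form in which
(2.29) enters Lemma 2.4, whose statement carries that hypothesis. [cite: Fournais2020, (2.29), (2.8), (2.24)] -/
theorem Fournais2020_eq229_of_rep :
    ∀ (v : ℝ → ℝ≥0∞), IsRepulsiveFiniteRange v → (∫⁻ x : Space, v ‖x‖) ≠ ⊤ →
    ∀ (ω : Space → ℝ), IsScatteringSolution v ω →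
    ∀ (χ : Space → ℝ), IsLocalizationFunction χ →
    ∀ (C R : ℝ), 0 ≤ C → (∀ y : Space, 1 - C * ‖y‖ ^ 2 ≤ selfConv χ y) → 0 < R → (∀ r, R < r → v r = 0) →
    ∀ (ℓ s b : ℝ), 0 < ℓ → 0 < s → 0 < b → C * (R / ℓ) ^ 2 ≤ 1 / 2 →
    ∀ (n : ℕ) (u : Space) (Φ : Config n → ℂ), Measurable Φ →
      (∫⁻ X in boxConfig n ℓ u, ((‖Φ X‖₊ : ℝ≥0∞)) ^ 2) ≠ ⊤ →
      (∫⁻ X in boxConfig n ℓ u, repBoxN v χ ℓ u X * (‖Φ X‖₊ : ℝ≥0∞) ^ 2) ≠ ⊤ →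
      kinBoxN χ ℓ s b u Φ ≠ ⊤ →
      Integrable (fun p : Space =>
          (𝓕 (fun x : Space => ((bigW₁ v ω χ ℓ x).toReal : ℂ)) p).re * pairingRe χ ℓ u p Φ) ∧
        a2Form v ω χ ℓ u Φ =
          ∫ p : Space, (𝓕 (fun x : Space => ((bigW₁ v ω χ ℓ x).toReal : ℂ)) p).re * pairingRe χ ℓ u p Φ := by
  intro v hv hvi ω hω χ hχ C R hC hχC hR0 hR ℓ s b hℓ hs hb hsmall n u Φ hΦm hN2 hrep hkin
  have hvm : Measurable v := hv.1
  obtain ⟨Cχ, hCχ⟩ := hχ.exists_bound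
  have hχc : Continuous χ := hχ.continuous
  -- the potential `W₁` as a real function
  set W : Space → ℝ := fun x => (bigW₁ v ω χ ℓ x).toReal with hW
  have hWm : Measurable W := (measurable_bigW₁ hvm hω.measurable hχ ℓ).ennreal_toReal
  have hW0 : ∀ x, 0 ≤ W x := fun x => ENNReal.toReal_nonneg
  have hWe : ∀ x, W (-x) = W x := fun x => by simp only [hW, bigW₁_neg v hω hχ ℓ x]
  have hWi : Integrable W := (integral_toReal_bigW₁_le_sharp hvm hR hvi hℓ hC hχ hχC hsmall hω).1
  cases n with
  | zero =>
    have hA2 : a2Form v ω χ ℓ u Φ = 0 := by simp [a2Form]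
    have h0 : (fun p : Space => (𝓕 (fun x : Space => ((bigW₁ v ω χ ℓ x).toReal : ℂ)) p).re *
        pairingRe χ ℓ u p Φ) = fun _ => 0 := by
      funext p
      rw [pairingRe_zero, mul_zero]
    rw [h0, hA2, integral_zero]
    exact ⟨integrable_zero _ _ _, rfl⟩
  | succ m =>
    have hΦ2 : MemLp Φ 2 ((volume : Measure (Config (m + 1))).restrict (boxConfig (m + 1) ℓ u)) :=
      memLp_two_of_lintegral_ne_top hΦm.aestronglyMeasurable hN2
    -- finiteness of `n₊` and of the kinetic excitation form
    have hNPt : nPlusBoxN ℓ u Φ ≠ ⊤ := by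
      intro htop
      have h := kinExcForm_add_le_kinBoxN χ ℓ s b u Φ
      rw [htop, ENNReal.mul_top (by simpa using div_pos hb (pow_pos hℓ 2)), add_top, top_le_iff] at h
      exact hkin h
    obtain ⟨hTt, -⟩ := toReal_kinExcForm_add_le χ ℓ s (b := b) (by positivity) u Φ hkin hNPt
    -- the Coulomb energy of `W₁` is finite, (2.42)
    have hsL : scatteringLength v ≠ ⊤ := by
      refine scatteringLength_ne_top ?_
      rw [lintegral_const_mul' _ _ (ENNReal.inv_ne_top.2 two_ne_zero)]
      exact ENNReal.mul_ne_top (ENNReal.inv_ne_top.2 two_ne_zero) hvi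
    have hgΩt : gOmegaIntegral v ω ≠ ⊤ :=
      ne_top_of_le_ne_top (ENNReal.mul_ne_top ENNReal.ofReal_ne_top hsL) (gOmegaIntegral_le hω)
    have h242 := Fournais2020_eq242_holds v hv hvi ω hω χ hχ C R hC hχC hR0 hR ℓ hℓ hsmall
    have hCoulW : (∫⁻ p : Space, ENNReal.ofReal
        (‖𝓕 (fun x : Space => (W x : ℂ)) p‖ ^ 2 * ((2 * Real.pi) ^ 2 * ‖p‖ ^ 2)⁻¹)) ≠ ⊤ := by
      have e : ∀ a q : ℝ, a * ((2 * Real.pi) ^ 2 * q)⁻¹ = 2 * (a / (8 * Real.pi ^ 2 * q)) := fun a q => by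
        rw [div_eq_mul_inv]
        ring
      have hcalc : (∫⁻ p : Space, ENNReal.ofReal
          (‖𝓕 (fun x : Space => ((bigW₁ v ω χ ℓ x).toReal : ℂ)) p‖ ^ 2 * ((2 * Real.pi) ^ 2 * ‖p‖ ^ 2)⁻¹)) ≤
          2 * (ENNReal.ofReal ((1 + 2 * C * (R / ℓ) ^ 2) ^ 2) * gOmegaIntegral v ω) := by
        calc ∫⁻ p : Space, ENNReal.ofReal (‖𝓕 (fun x : Space => ((bigW₁ v ω χ ℓ x).toReal : ℂ)) p‖ ^ 2 *
              ((2 * Real.pi) ^ 2 * ‖p‖ ^ 2)⁻¹)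
            = ∫⁻ p : Space, 2 * ENNReal.ofReal (‖𝓕 (fun x : Space => ((bigW₁ v ω χ ℓ x).toReal : ℂ)) p‖ ^ 2 /
                (8 * Real.pi ^ 2 * ‖p‖ ^ 2)) := by
              refine lintegral_congr fun p => ?_
              rw [e, ENNReal.ofReal_mul zero_le_two, ENNReal.ofReal_ofNat]
          _ = 2 * ∫⁻ p : Space, ENNReal.ofReal (‖𝓕 (fun x : Space => ((bigW₁ v ω χ ℓ x).toReal : ℂ)) p‖ ^ 2 /
                (8 * Real.pi ^ 2 * ‖p‖ ^ 2)) := lintegral_const_mul' _ _ ENNReal.ofNat_ne_top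
          _ ≤ 2 * (ENNReal.ofReal ((1 + 2 * C * (R / ℓ) ^ 2) ^ 2) * gOmegaIntegral v ω) := mul_le_mul_right h242 _
      have h := ne_top_of_le_ne_top (ENNReal.mul_ne_top ENNReal.ofNat_ne_top
        (ENNReal.mul_ne_top ENNReal.ofReal_ne_top hgΩt)) hcalc
      simpa only [hW] using h
    have hCoulWxy : (∫⁻ x : Space, ∫⁻ y : Space, ENNReal.ofReal (W x * W y * (4 * Real.pi * ‖x - y‖)⁻¹)) ≠ ⊤ := by
      rwa [← lintegral_normSq_fourier_div_eq hWm hWi hW0]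
    -- the marginal bound `∫_Λ w(y,x)dy ≤ K < ∞` for the finiteness lemmas of `PeriodicBoseGasEq225.lean`
    have hD : ∀ y : Space, ‖y‖ ≤ R / ℓ → 2⁻¹ ≤ selfConv χ y := by
      intro y hy
      have h1 := hχC y
      have h2 : C * ‖y‖ ^ 2 ≤ C * (R / ℓ) ^ 2 := mul_le_mul_of_nonneg_left (pow_le_pow_left₀ (norm_nonneg _) hy 2) hC
      linarith
    have hK : ∀ x : Space, ∫⁻ y in slidingBox ℓ u, pairLoc v χ ℓ u y x ≤
        ENNReal.ofReal Cχ * ENNReal.ofReal Cχ * 2 * ∫⁻ z : Space, v ‖z‖ := fun x =>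
      kbound_pairLoc (u := u) hχ hR hℓ hCχ hD le_rfl x
    have hK' : ENNReal.ofReal Cχ * ENNReal.ofReal Cχ * 2 * ∫⁻ z : Space, v ‖z‖ ≠ ⊤ :=
      ENNReal.mul_ne_top (ENNReal.mul_ne_top (ENNReal.mul_ne_top ENNReal.ofReal_ne_top ENNReal.ofReal_ne_top)
        ENNReal.ofNat_ne_top) hvi
    -- per-pair integrability of the `A₂` integrand (finite repulsion)
    have hIpair : ∀ i j : Fin (m + 1), i ≠ j → Integrable (fun X => (W (X i - X j) : ℂ) *
        (conj (nbodyP ℓ u i (nbodyP ℓ u j Φ) X) *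
          ((locFun χ ℓ u (X i) : ℂ) * ((locFun χ ℓ u (X j) : ℂ) * nbodyQ ℓ u j (nbodyQ ℓ u i Φ) X))))
        ((volume : Measure (Config (m + 1))).restrict (boxConfig (m + 1) ℓ u)) := by
      intro i j hij
      have hw₁ := measurable_pairLoc₁₂ hvm hω.measurable hχ ℓ u
      have hπ : Measurable fun X : Config (m + 1) => (X i, X j) :=
        (measurable_pi_apply i).prodMk (measurable_pi_apply j)
      have hw₁ij : AEMeasurable (fun X : Config (m + 1) => pairLoc₁ v ω χ ℓ u (X i) (X j))
          ((volume : Measure (Config (m + 1))).restrict (boxConfig (m + 1) ℓ u)) := (hw₁.comp hπ).aemeasurable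
      have hfin : ∫⁻ X in boxConfig (m + 1) ℓ u, pairLoc v χ ℓ u (X i) (X j) * (‖Φ X‖₊ : ℝ≥0∞) ^ 2 ≠ ⊤ :=
        ne_top_of_le_ne_top hrep (lintegral_mono fun X => mul_le_mul' (pairLoc_le_repBoxN hχ ℓ u hij X) le_rfl)
      have mono₁ : ∀ X : Config (m + 1), pairLoc₁ v ω χ ℓ u (X i) (X j) ≤ pairLoc v χ ℓ u (X i) (X j) :=
        fun X => pairLoc₁_le_pairLoc hω χ ℓ u _ _
      have fpp := lintegral_mul_norm_sq_ne_top_mono mono₁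
        (lintegral_pairLoc_nbodyPP_ne_top hℓ hχ hvm hK hK' hΦm hΦ2 hij)
      have fq := lintegral_mul_norm_sq_ne_top_mono mono₁
        (lintegral_pairLoc_nbodyQQ_ne_top hℓ hχ hvm hK hK' hΦm hΦ2 hij hfin)
      have hI := integrable_toReal_mul_conj_mul hw₁ij
        (measurable_nbodyP ℓ u i (measurable_nbodyP ℓ u j hΦm)).aestronglyMeasurable
        (measurable_nbodyQ ℓ u j (measurable_nbodyQ ℓ u i hΦm)).aestronglyMeasurable fpp fq
      refine hI.congr (Eventually.of_forall fun X => ?_)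
      simp only [toReal_pairLoc₁_eq hχ, hW]
      push_cast
      ring
    -- `⟨Φ, A₂Φ⟩` is the `N = ∞` member of the family
    have hA2 : a2Form v ω χ ℓ u Φ = ∑ i : Fin (m + 1), ∑ j : Fin (m + 1) with j ≠ i,
        (∫ X in boxConfig (m + 1) ℓ u, (W (X i - X j) : ℂ) *
          (conj (nbodyP ℓ u i (nbodyP ℓ u j Φ) X) *
            ((locFun χ ℓ u (X i) : ℂ) * ((locFun χ ℓ u (X j) : ℂ) * nbodyQ ℓ u j (nbodyQ ℓ u i Φ) X)))).re := by
      unfold a2Form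
      refine Finset.sum_congr rfl fun i _ => Finset.sum_congr rfl fun j _ => ?_
      congr 1
      refine integral_congr_ae (Eventually.of_forall fun X => ?_)
      simp only [toReal_pairLoc₁_eq hχ, hW]
      push_cast
      ring
    -- the truncations `U_N = min(W₁, N)`
    set U : ℕ → Space → ℝ := fun N x => min (W x) N with hU
    have hUm : ∀ N, Measurable (U N) := fun N => hWm.min measurable_const
    have hUe : ∀ N x, U N (-x) = U N x := fun N x => by simp only [hU, hWe]
    have hUb : ∀ (N : ℕ) x, |U N x| ≤ N := fun N x => by
      simp only [hU]
      rw [abs_of_nonneg (le_min (hW0 x) (Nat.cast_nonneg N))]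
      exact min_le_right _ _
    have hUi : ∀ N, Integrable (U N) := fun N =>
      hWi.mono' (hUm N).aestronglyMeasurable (Eventually.of_forall fun x => by
        simp only [hU]
        rw [Real.norm_of_nonneg (le_min (hW0 x) (Nat.cast_nonneg N))]
        exact min_le_left _ _)
    have hUN := fun N : ℕ => sum_re_integral_pairPotential_eq hχ hℓ hΦm hΦ2 (hUm N) (hUe N) (hUb N) (hUi N)
    -- the position side converges to `⟨Φ, A₂Φ⟩`
    have hL : Tendsto (fun N : ℕ => ∑ i : Fin (m + 1), ∑ j : Fin (m + 1) with j ≠ i,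
        (∫ X in boxConfig (m + 1) ℓ u, (U N (X i - X j) : ℂ) *
          (conj (nbodyP ℓ u i (nbodyP ℓ u j Φ) X) *
            ((locFun χ ℓ u (X i) : ℂ) * ((locFun χ ℓ u (X j) : ℂ) * nbodyQ ℓ u j (nbodyQ ℓ u i Φ) X)))).re)
        atTop (𝓝 (a2Form v ω χ ℓ u Φ)) := by
      rw [hA2]
      refine tendsto_finsetSum _ fun i _ => tendsto_finsetSum _ fun j hj => ?_
      have hij : i ≠ j := Ne.symm (Finset.mem_filter.1 hj).2
      have hχm : Measurable fun y : Space => (locFun χ ℓ u y : ℂ) := by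
        unfold locFun
        exact Complex.measurable_ofReal.comp (hχc.measurable.comp (measurable_const_smul _ |>.comp
          (measurable_id.sub measurable_const)))
      have hKfm : AEStronglyMeasurable (fun X : Config (m + 1) => conj (nbodyP ℓ u i (nbodyP ℓ u j Φ) X) *
          ((locFun χ ℓ u (X i) : ℂ) * ((locFun χ ℓ u (X j) : ℂ) * nbodyQ ℓ u j (nbodyQ ℓ u i Φ) X)))
          ((volume : Measure (Config (m + 1))).restrict (boxConfig (m + 1) ℓ u)) :=
        ((Complex.continuous_conj.measurable.comp (measurable_nbodyP ℓ u i (measurable_nbodyP ℓ u j hΦm))).mul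
          ((measurable_comp_eval hχm i).mul ((measurable_comp_eval hχm j).mul
            (measurable_nbodyQ ℓ u j (measurable_nbodyQ ℓ u i hΦm))))).aestronglyMeasurable
      have h := tendsto_integral_min_mul (μ := (volume : Measure (Config (m + 1))).restrict (boxConfig (m + 1) ℓ u))
        (hWm.comp ((measurable_pi_apply i).sub (measurable_pi_apply j))) (fun X => hW0 _) hKfm (hIpair i j hij)
      exact (Complex.continuous_re.tendsto _).comp h
    -- the momentum side converges to `∫ Ŵ₁ Re⟨b†Φ, bΦ⟩`
    have hBk := lintegral_weight_normSq_bVec_ne_top hχc hCχ hℓ s u hΦm hTt hNPt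
    have hIW : Integrable (fun p : Space => (𝓕 (fun x : Space => (W x : ℂ)) p).re * pairingRe χ ℓ u p Φ) :=
      integrable_re_fourier_mul_pairingRe hχ hCχ hℓ u hΦm hWi hN2 hCoulW hBk
    have hRt : Tendsto (fun N : ℕ => ∫ p : Space, (𝓕 (fun x : Space => (U N x : ℂ)) p).re * pairingRe χ ℓ u p Φ)
        atTop (𝓝 (∫ p : Space, (𝓕 (fun x : Space => (W x : ℂ)) p).re * pairingRe χ ℓ u p Φ)) := by
      rw [tendsto_iff_edist_tendsto_0]
      set D2 : ℝ≥0∞ := ENNReal.ofReal (((m + 1 : ℕ) : ℝ) * (2 * Cχ) ^ 2) * (m + 1 : ℕ) *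
        ∫⁻ X in boxConfig (m + 1) ℓ u, ((‖Φ X‖₊ : ℝ≥0∞)) ^ 2 with hD2
      set Bk : ℝ≥0∞ := ∫⁻ p : Space, ENNReal.ofReal ((2 * Real.pi) ^ 2 * ‖p‖ ^ 2) *
        ∫⁻ X in boxConfig (m + 1) ℓ u, ((‖bVec χ ℓ u (-p) Φ X‖₊ : ℝ≥0∞)) ^ 2 with hBkdef
      set Coul : ℕ → ℝ≥0∞ := fun N => ∫⁻ p : Space, ENNReal.ofReal
        (‖𝓕 (fun x : Space => ((W x - min (W x) N : ℝ) : ℂ)) p‖ ^ 2 * ((2 * Real.pi) ^ 2 * ‖p‖ ^ 2)⁻¹) with hCoul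
      have hD2t : D2 ≠ ⊤ := ENNReal.mul_ne_top (ENNReal.mul_ne_top ENNReal.ofReal_ne_top (ENNReal.natCast_ne_top _)) hN2
      have hCoulN : Tendsto Coul atTop (𝓝 0) := tendsto_coulomb_truncation hWm hW0 hWi hCoulWxy
      have hbound : ∀ N : ℕ, edist (∫ p : Space, (𝓕 (fun x : Space => (U N x : ℂ)) p).re * pairingRe χ ℓ u p Φ)
          (∫ p : Space, (𝓕 (fun x : Space => (W x : ℂ)) p).re * pairingRe χ ℓ u p Φ) ≤
          D2 ^ (1 / 2 : ℝ) * (Coul N ^ (1 / 2 : ℝ) * Bk ^ (1 / 2 : ℝ)) := fun N => by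
        rw [edist_comm, edist_eq_enorm_sub]
        exact enorm_integral_re_fourier_mul_pairingRe_sub_le hχ hCχ hℓ u hΦm hWi (hUi N) hIW (hUN N).1
      have hupper : Tendsto (fun N : ℕ => D2 ^ (1 / 2 : ℝ) * (Coul N ^ (1 / 2 : ℝ) * Bk ^ (1 / 2 : ℝ))) atTop (𝓝 0) := by
        have h1 : Tendsto (fun N : ℕ => Coul N ^ (1 / 2 : ℝ)) atTop (𝓝 0) := by
          have h := ((ENNReal.continuous_rpow_const (y := (1 / 2 : ℝ))).tendsto 0).comp hCoulN
          rwa [ENNReal.zero_rpow_of_pos (by norm_num)] at h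
        have h2 : Tendsto (fun N : ℕ => Coul N ^ (1 / 2 : ℝ) * Bk ^ (1 / 2 : ℝ)) atTop (𝓝 0) := by
          have h := ENNReal.Tendsto.mul_const h1 (Or.inr (ENNReal.rpow_ne_top_of_nonneg (by norm_num : (0 : ℝ) ≤ 1 / 2) hBk))
          rwa [zero_mul] at h
        have h3 := ENNReal.Tendsto.const_mul h2 (Or.inr (ENNReal.rpow_ne_top_of_nonneg (by norm_num : (0 : ℝ) ≤ 1 / 2) hD2t))
        rwa [mul_zero] at h3
      exact tendsto_of_tendsto_of_tendsto_of_le_of_le tendsto_const_nhds hupper (fun N => zero_le) hbound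
    -- conclude
    have hL' : Tendsto (fun N : ℕ => ∫ p : Space, (𝓕 (fun x : Space => (U N x : ℂ)) p).re * pairingRe χ ℓ u p Φ)
        atTop (𝓝 (a2Form v ω χ ℓ u Φ)) := hL.congr fun N => (hUN N).2
    exact ⟨hIW, tendsto_nhds_unique hL' hRt⟩

end Assembly

end Literature.MathematicalPhysics.QuantumManyBody.BoseGas

end
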